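import Summits.HodgeConjecture.FermatCycles.ConditionQPrimePower
import HarnessLib

/-!
# Shioda's conditions at every level prime to `6`, in every dimension: `(Qⁿₘ) ⟺ (Pⁿₘ) ⟺ (m prime ∨ n + 2 ≤ p₁)`, `p₁ = minFac m`

HONEST FRAMING: explicit algebraic cycles for specific Hodge classes on Fermat/Delsarte varieties;
residual open instances listed; no claim on general Hodge.

Topic path `Summits/HodgeConjecture/FermatCycles/` of cell `pub-hfermat`; the closing file of the by-product `ConditionQ*` on Shioda's
question [Shioda1979HodgeFermat, p. 184] ("we do not know any value of m which satisfies (Qₘ) but not (Pₘ)"). The companions settled,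
with no hypothesis beyond `gcd(m, 6) = 1`: all lengths together (`ConditionQPrimeToSix`: `(Qₘ) ⟺ m` prime `⟺ (Pₘ)`), length `≤ 6`
(`ConditionQPrimeToSixFourfold`: `(Q⁴ₘ) ⟺ (P⁴ₘ) ⟺ ¬(5 ∣ m ∧ m > 5)`) and prime-power levels (`ConditionQPrimePower`:
`(Qⁿ_{pᵏ}) ⟺ (Pⁿ_{pᵏ}) ⟺ n + 2 ≤ p`). THIS FILE gives the exact threshold in the dimension at EVERY composite level prime to `6`
(`composite_iff`), and hence the complete comparison of the two conditions at levels prime to `6` (`coprimeSix_iff`):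

**for `m > 1` with `gcd(m, 6) = 1` and every `n`: `(Qⁿₘ) ⟺ (Pⁿₘ) ⟺ (m` is prime, or `n + 2 ≤ p₁)`, `p₁ :=` the least prime factor of `m`.**

So Shioda's inductive method for `Xⁿₘ` — in the original form `(Pⁿₘ)` [Shioda1979HodgeFermat, Thm IV; Shioda1979PJA, Thm 1] or the stable
form `(Qⁿₘ)` [Shioda1979HodgeFermat, §4] — works at a composite level prime to `6` exactly in the dimensions `n ≤ p₁ − 2`, the range of
[Aoki1983, Thm A] (`𝔅ⁿₘ = 𝔇ⁿₘ` iff every prime factor of `m` exceeds `n + 2`; for even `n` and odd `p₁`, `n + 2 ≤ p₁ ⟺ p₁ > n + 2`), and the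
weakening `(P) ↦ (Q)` never gains a level prime to `6` in any dimension. Instances (`composite_thresholds`, `instances`): `(P⁴ₘ) ⟺ 5 ∤ m`;
`(P⁶ₘ) ⟺ (P⁸ₘ) ⟺ p₁ ≥ 11` (first composite level `m = 121`; first with two primes `m = 143`); `(P⁴₁₀₀₁)` holds, `(Q⁶₁₀₀₁)` fails.

THE ARGUMENT. (i) `isSymmetric_of_card_lt_minFac`: at a level `m > 1` prime to `6`, a Hodge multiset with fewer than `p₁` entries is
symmetric. INPUT (a theorem of the tree, line `cancel-by-any-claim-lattice`, programme GS²: `PairedNull.stub_exists_fibre_of_not_paired_pow`,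
[Aoki1983, Thm A′ §7, Prop. 2.2, Prop. 6.4]): at a level prime to `6` all of whose prime factors other than `p₁` are `≥ #s + 3`, a
non-symmetric Hodge multiset `s` contains all but one of the `p₁` points `A + j(m/p₁)` of a progression with `p₁A ≠ 0`. With `p₁ = minFac m`
the side condition holds as soon as `#s < p₁`: another prime factor `q` is odd and `> p₁`, so `q ≥ p₁ + 2 ≥ #s + 3`. Then `s` IS those
`p₁ − 1` points (`ConditionQPrimeToSix.progression_le`), its sum `(p₁ − 1)A + c·(m/p₁)` vanishes, and `p₁ ·` that is `(p₁ − 1)·p₁A = 0` with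
`p₁ − 1` a unit modulo `m` (`Nat.coprime_of_lt_minFac`) — contradicting `p₁A ≠ 0`. (ii) `composite_iff`: if `n + 2 ≤ p₁`, a Hodge multiset
with `6 ≤ #s ≤ n + 2` has (parity) `#s < p₁`, so it is symmetric, `= Q + (−Q)` (tree: `CoprimeSix.exists_pairs_of_count_symm`), hence
decomposable and in `M'ₘ`: `(Pⁿₘ)` and `(Qⁿₘ)` hold. If `n + 2 > p₁ = 2r + 1`, then `m/p₁ ≥ p₁ ≥ 5` (`m` composite) and Aoki's `σ_{p₁,1}`
(`p₁ + 1 ≤ n + 2` entries, not symmetric) refutes `(Qⁿₘ)`, hence `(Pⁿₘ)` (`ConditionQPrimeToSix.coprimeSix_consequences`, resting on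
`mPrime_symmetric_of_coprime_six`). (iii) `coprimeSix_iff`: at a prime level both conditions hold in every dimension (Parry's lemma, tree
`shiodaCondition_of_prime`). No hypothesis, no fact, no `sorry`.

Second implementation of the numerical content (cell rule): `HOME/code/lit/q4/symcheck.py` (brute force over all Hodge multisets with
`#s < p₁`, resp. `#s ≤ 6`, at the composite levels `m ≤ 203` prime to `6` within reach) and the cell's `P4-TABLE.md` (`(P⁴ₘ)` at the nine
composite levels `≤ 100` prime to `6`: true at `49, 77, 91`, false at `25, 35, 55, 65, 85, 95` — `= (7 ≤ p₁)`).

References: [Shioda1979HodgeFermat] T. Shioda, The Hodge conjecture for Fermat varieties, Math. Ann. 245 (1979) 175–184, Thm IV, §4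
pp. 183–184; [Shioda1979PJA] T. Shioda, Proc. Japan Acad. 55A (1979) 111–114, Thm 1; [Aoki1983] N. Aoki, On some arithmetic problems related
to the Hodge cycles on the Fermat varieties, Math. Ann. 266 (1983) 23–54, Thm A, Thm A′ (§7); [Aoki1987] N. Aoki, Some new algebraic cycles on
Fermat varieties, J. Math. Soc. Japan 39 (1987) 385–396, §1 (σ_{p,i}); [Ran1980] Z. Ran, Cycles on Fermat hypersurfaces, Compositio Math. 42
(1980) 121–142, Prop. 1.8 (prime degree).
-/

namespace Summit.HodgeConjecture.FermatCycles.ConditionQCoprimeSixThreshold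

open Multiset
open Literature.AlgebraicGeometry.HodgeTheory Literature.AlgebraicGeometry.HodgeTheory.FermatCharacter
open Literature.AlgebraicGeometry.Shioda1979 Literature.AlgebraicGeometry.Shioda1981
open Summit.HodgeConjecture.FermatCycles.ConditionQSymmetric Summit.HodgeConjecture.FermatCycles.ConditionQCoprimeSix
open Summit.HodgeConjecture.FermatCycles.ConditionQPrimeToSix Summit.HodgeConjecture.FermatCycles.ConditionQPrimeToSixFourfold
open Summit.HodgeConjecture.HodgeConjecture.Theorems.CancelByAnyClaimLattice

variable {m : ℕ}

/-! ### The least prime factor of a level prime to `6` -/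

/-- The least prime factor of a level `m > 1` prime to `6` is at least `5`. [folklore] -/
theorem five_le_minFac (h6 : Nat.Coprime m 6) (h1 : 1 < m) : 5 ≤ m.minFac := by
  have hp : m.minFac.Prime := Nat.minFac_prime (show m ≠ 1 by omega)
  have hc : Nat.Coprime m.minFac 6 := Nat.Coprime.coprime_dvd_left (Nat.minFac_dvd m) h6
  generalize m.minFac = p at hp hc ⊢
  by_contra hlt
  have h2 := hp.two_le
  have h5 : p < 5 := by omega
  interval_cases p
  · exact absurd hc (by norm_num)
  · exact absurd hc (by norm_num)
  · exact absurd hp (by norm_num)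

/-- At a level prime to `6`, every prime factor other than the least one `p₁` is at least `p₁ + 2` (both are odd). [folklore] -/
theorem minFac_add_two_le (h6 : Nat.Coprime m 6) {q : ℕ} (hq : q ∈ m.primeFactors) (hne : q ≠ m.minFac) :
    m.minFac + 2 ≤ q := by
  rw [Nat.mem_primeFactors] at hq
  obtain ⟨hqp, hqm, -⟩ := hq
  have hle : m.minFac ≤ q := Nat.minFac_le_of_dvd hqp.two_le hqm
  have hqc : Nat.Coprime q 6 := Nat.Coprime.coprime_dvd_left hqm h6
  have hpc : Nat.Coprime m.minFac 6 := Nat.Coprime.coprime_dvd_left (Nat.minFac_dvd m) h6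
  have hq2 : ¬ 2 ∣ q := fun h2 ↦ by
    have h := Nat.Coprime.coprime_dvd_left h2 hqc
    norm_num at h
  have hp2 : ¬ 2 ∣ m.minFac := fun h2 ↦ by
    have h := Nat.Coprime.coprime_dvd_left h2 hpc
    norm_num at h
  omega

/-- `p₁ − 1` is a unit modulo `m` (`p₁ = minFac m`, `m > 1`). [folklore] -/
theorem coprime_minFac_sub_one (h1 : 1 < m) : Nat.Coprime (m.minFac - 1) m := by
  have h2 := (Nat.minFac_prime (show m ≠ 1 by omega)).two_le
  exact (Nat.coprime_of_lt_minFac (by omega) (by omega)).symm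

/-- For composite `m` prime to `6`: `m / p₁ ≥ 3` (indeed `≥ p₁ ≥ 5`, as `p₁² ≤ m`). [folklore] -/
theorem three_le_div_minFac (h6 : Nat.Coprime m 6) (h1 : 1 < m) (hnp : ¬ m.Prime) : 3 ≤ m / m.minFac := by
  have hp5 := five_le_minFac h6 h1
  have hsq : m.minFac ^ 2 ≤ m := Nat.minFac_sq_le_self (by omega) hnp
  rw [Nat.le_div_iff_mul_le (by omega)]
  nlinarith

/-! ### Hodge multisets shorter than `p₁` are symmetric -/

/-- **At a level `m > 1` prime to `6`, every Hodge multiset with fewer than `p₁ = minFac m` entries is symmetric.** By the tree's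
`PairedNull.stub_exists_fibre_of_not_paired_pow` (applicable: a prime factor `q ≠ p₁` has `q ≥ p₁ + 2 ≥ #s + 3`) a non-symmetric one
contains `p₁ − 1` distinct points `A + j(m/p₁)` (`p₁A ≠ 0`), hence consists of them, and `p₁ ·` its (vanishing) sum is `(p₁ − 1)·p₁A ≠ 0`,
`p₁ − 1` being prime to `m`. [cite: Aoki1983, Thm A′ (§7)] -/
theorem isSymmetric_of_card_lt_minFac [NeZero m] (h6 : Nat.Coprime m 6) (h1 : 1 < m)
    {s : Multiset (ZMod m)} (hs : IsHodgeMultiset s) (hcard : card s < m.minFac) : IsSymmetric s := by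
  have hp : m.minFac.Prime := Nat.minFac_prime (show m ≠ 1 by omega)
  have hp5 : 5 ≤ m.minFac := five_le_minFac h6 h1
  have hpm : m.minFac ∣ m := Nat.minFac_dvd m
  by_contra hns
  obtain ⟨x, hx⟩ : ∃ x, count x s ≠ count (-x) s := by
    by_contra hall
    push Not at hall
    exact hns hall
  have hbig : ∀ q ∈ m.primeFactors, q ≠ m.minFac → card s + 3 ≤ q := by
    intro q hq hqp
    have h := minFac_add_two_le h6 hq hqp
    omega
  obtain ⟨-, A, hA, j₀, hj₀, hfib⟩ :=
    PairedNull.stub_exists_fibre_of_not_paired_pow m.minFac hp hp5 m h6 s hs hbig ⟨x, hx⟩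
  -- the `p₁ - 1` progression points fill `s`
  set S : Finset ℕ := (Finset.range m.minFac).erase j₀ with hS_def
  have hSlt : ∀ j ∈ S, j < m.minFac := fun j hj ↦ Finset.mem_range.mp (Finset.mem_of_mem_erase hj)
  have hSmem : ∀ j ∈ S, A + (j : ZMod m) * ((m / m.minFac : ℕ) : ZMod m) ∈ s := fun j hj ↦
    hfib j (hSlt j hj) (Finset.ne_of_mem_erase hj)
  have hle := progression_le hpm S hSlt s hSmem
  have hScard : S.card = m.minFac - 1 := by
    rw [hS_def, Finset.card_erase_of_mem (Finset.mem_range.mpr hj₀), Finset.card_range]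
  have heq := Multiset.eq_of_le_of_card_le hle (by rw [Multiset.card_map, Finset.card_val, hScard]; omega)
  -- its sum vanishes: `(p₁-1)•A + c·(m/p₁) = 0`
  have hsum := hs.1.2
  rw [← heq, Multiset.sum_map_add, Multiset.sum_map_mul_right, Multiset.map_const', Multiset.sum_replicate, Finset.card_val,
    hScard, nsmul_eq_mul] at hsum
  have hpd : (m.minFac : ZMod m) * ((m / m.minFac : ℕ) : ZMod m) = 0 := by
    rw [← Nat.cast_mul, Nat.mul_div_cancel' hpm, ZMod.natCast_self]
  have hu : IsUnit ((m.minFac - 1 : ℕ) : ZMod m) := by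
    have h := (ZMod.unitOfCoprime (m.minFac - 1) (coprime_minFac_sub_one h1)).isUnit
    rwa [ZMod.coe_unitOfCoprime] at h
  apply hA
  have e : ((m.minFac - 1 : ℕ) : ZMod m) * ((m.minFac : ZMod m) * A) = 0 := by
    linear_combination (m.minFac : ZMod m) * hsum
      - (Multiset.map (fun j : ℕ ↦ (j : ZMod m)) S.val).sum * hpd
  exact hu.mul_right_eq_zero.mp e

/-! ### The threshold in the dimension at composite levels prime to `6` -/

/-- **Composite levels prime to `6`: `(Qⁿₘ) ⟺ (Pⁿₘ) ⟺ n + 2 ≤ p₁`** (`p₁ = minFac m`). If `n + 2 ≤ p₁`, a Hodge multiset with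
`6 ≤ #s ≤ n + 2` has (parity) `#s < p₁`, so is symmetric, `= Q + (−Q)`, decomposable and in `M'ₘ`; if `n + 2 > p₁`, Aoki's `σ_{p₁,1}`
(`p₁ + 1` entries, `m/p₁ ≥ 3`, not symmetric while `M'ₘ` is) refutes `(Qⁿₘ)`, hence `(Pⁿₘ)`.
[cite: Shioda1979HodgeFermat, §4 pp. 183–184 ((Pⁿₘ) ⇒ (Qⁿₘ); the question p. 184)] [cite: Aoki1983, Thm A and Thm A′ (§7)]
[cite: Aoki1987, §1 p. 387 (σ_{p,1})] -/
theorem composite_iff [NeZero m] (h6 : Nat.Coprime m 6) (h1 : 1 < m) (hnp : ¬ m.Prime) (n : ℕ) :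
    (ConditionQ m n ↔ n + 2 ≤ m.minFac) ∧ (ShiodaConditionUpTo m n ↔ n + 2 ≤ m.minFac) := by
  have hp : m.minFac.Prime := Nat.minFac_prime (show m ≠ 1 by omega)
  have hp5 : 5 ≤ m.minFac := five_le_minFac h6 h1
  have hpm : m.minFac ∣ m := Nat.minFac_dvd m
  -- `n + 2 ≤ p₁` ⇒ `(Pⁿ)`
  have hP : n + 2 ≤ m.minFac → ShiodaConditionUpTo m n := by
    intro hn2 s hs h6le hle
    obtain ⟨c, hc⟩ := hs.even_card
    have hcard : card s < m.minFac := by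
      obtain ⟨r, hr⟩ := hp.odd_of_ne_two (by omega)
      omega
    have hsym := isSymmetric_of_card_lt_minFac h6 h1 hs hcard
    obtain ⟨Q, hQ0, rfl⟩ := CoprimeSix.exists_pairs_of_count_symm h6 _ s rfl hs hsym
    have hQcard : 3 ≤ card Q := by
      rw [Multiset.card_add, Multiset.card_map] at h6le
      omega
    obtain ⟨a, Q', rfl⟩ : ∃ a Q', Q = a ::ₘ Q' := by
      induction Q using Multiset.induction with
      | empty => simp at hQcard
      | cons a Q' _ => exact ⟨a, Q', rfl⟩
    have ha : a ≠ 0 := hQ0 a (Multiset.mem_cons_self a Q')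
    have hQ'0 : ∀ b ∈ Q', b ≠ 0 := fun b hb ↦ hQ0 b (Multiset.mem_cons_of_mem hb)
    have hQ'card : 2 ≤ card Q' := by rw [Multiset.card_cons] at hQcard; omega
    left
    refine ⟨{a, -a}, Q' + Q'.map (fun x ↦ -x), by simp, ?_, IsHodgeMultiset.pair ha,
      isHodgeMultiset_of_mem_mPrime (pairs_mem_mPrime Q' hQ'0), ?_⟩
    · intro h
      have := congrArg card h
      rw [Multiset.card_add, Multiset.card_map, Multiset.card_zero] at this
      omega
    · simp only [Multiset.map_cons, Multiset.cons_add, Multiset.add_cons, insert_eq_cons, singleton_add]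
      rw [Multiset.cons_swap]
  -- `n + 2 > p₁ = 2r + 1` ⇒ `¬(Qⁿ)`: Aoki's `σ_{p₁,1}`, `m/p₁ ≥ 3`
  have hQ : ¬ n + 2 ≤ m.minFac → ¬ ConditionQ m n := by
    intro hn2
    obtain ⟨r, hr⟩ := hp.odd_of_ne_two (by omega)
    have hd : 3 ≤ m / (2 * r + 1) := by rw [← hr]; exact three_le_div_minFac h6 h1 hnp
    exact (coprimeSix_consequences h6).1 r n (by omega) (hr ▸ hpm) hd (by omega)
  constructor
  · constructor
    · intro hQn
      by_contra hn2
      exact hQ hn2 hQn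
    · intro hn2
      exact conditionQ_of_shiodaConditionUpTo (hP hn2)
  · constructor
    · intro hPn
      by_contra hn2
      exact hQ hn2 (conditionQ_of_shiodaConditionUpTo hPn)
    · exact hP

/-- **Every level `m > 1` prime to `6`, every dimension: `(Qⁿₘ) ⟺ (Pⁿₘ) ⟺ (m prime ∨ n + 2 ≤ p₁)`** — Shioda's stable condition never
improves on the original one at a level prime to `6`; both hold exactly at the prime levels (Parry's lemma: every Hodge multiset splits off a
pair) and, at composite levels, in the dimensions `n ≤ p₁ − 2`. [cite: Shioda1979HodgeFermat, §4 pp. 183–184 and the question p. 184]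
[cite: Shioda1979PJA, §2 Thm 1, list item 1) (m prime)] [cite: Ran1980, Prop. 1.8 (i)] [cite: Aoki1983, Thm A and Thm A′ (§7)] -/
theorem coprimeSix_iff [NeZero m] (h6 : Nat.Coprime m 6) (h1 : 1 < m) (n : ℕ) :
    (ConditionQ m n ↔ (m.Prime ∨ n + 2 ≤ m.minFac)) ∧ (ShiodaConditionUpTo m n ↔ (m.Prime ∨ n + 2 ≤ m.minFac)) ∧
      (ConditionQ m n ↔ ShiodaConditionUpTo m n) := by
  by_cases hpr : m.Prime
  · have hP : ShiodaConditionUpTo m n := by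
      haveI : Fact m.Prime := ⟨hpr⟩
      exact shiodaCondition_iff_forall_upTo.1 shiodaCondition_of_prime n
    have hQ : ConditionQ m n := conditionQ_of_shiodaConditionUpTo hP
    exact ⟨iff_of_true hQ (Or.inl hpr), iff_of_true hP (Or.inl hpr), iff_of_true hQ hP⟩
  · obtain ⟨hQ, hP⟩ := composite_iff h6 h1 hpr n
    refine ⟨hQ.trans ?_, hP.trans ?_, hQ.trans hP.symm⟩ <;> simp [hpr]

/-! ### The cell's dimensions `n = 4, 6, 8` and first instances -/

/-- **The threshold in the cell's dimensions**, composite `m` prime to `6`: `(P⁴ₘ) ⟺ (Q⁴ₘ) ⟺ 7 ≤ p₁` (i.e. `5 ∤ m`;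
`ConditionQPrimeToSixFourfold.fourfold_iff_of_coprime_six`), `(P⁶ₘ) ⟺ (Q⁶ₘ) ⟺ 11 ≤ p₁ ⟺ (P⁸ₘ) ⟺ (Q⁸ₘ)` — so Shioda's method reaches
no composite Fermat sixfold or eightfold of degree prime to `6` below `m = 121`. [cite: Shioda1979HodgeFermat, §4 pp. 183–184]
[cite: Aoki1983, Thm A and Thm A′ (§7)] -/
theorem composite_thresholds [NeZero m] (h6 : Nat.Coprime m 6) (h1 : 1 < m) (hnp : ¬ m.Prime) :
    ((ShiodaConditionUpTo m 4 ↔ 7 ≤ m.minFac) ∧ (ConditionQ m 4 ↔ 7 ≤ m.minFac)) ∧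
    ((ShiodaConditionUpTo m 6 ↔ 11 ≤ m.minFac) ∧ (ConditionQ m 6 ↔ 11 ≤ m.minFac)) ∧
    ((ShiodaConditionUpTo m 8 ↔ 11 ≤ m.minFac) ∧ (ConditionQ m 8 ↔ 11 ≤ m.minFac)) := by
  have hp : m.minFac.Prime := Nat.minFac_prime (show m ≠ 1 by omega)
  have h4 := composite_iff h6 h1 hnp 4
  have h6' := composite_iff h6 h1 hnp 6
  have h8 := composite_iff h6 h1 hnp 8
  generalize m.minFac = p at hp h4 h6' h8 ⊢
  -- a prime `p` with `6 ≤ p` has `7 ≤ p`; with `8 ≤ p` or `10 ≤ p` it has `11 ≤ p`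
  have e4 : 4 + 2 ≤ p ↔ 7 ≤ p := by
    refine ⟨fun h ↦ ?_, fun h ↦ by omega⟩
    by_contra h'
    have hlo : 6 ≤ p := by omega
    have hhi : p < 7 := by omega
    interval_cases p
    exact absurd hp (by norm_num)
  have e6 : 6 + 2 ≤ p ↔ 11 ≤ p := by
    refine ⟨fun h ↦ ?_, fun h ↦ by omega⟩
    by_contra h'
    have hlo : 8 ≤ p := by omega
    have hhi : p < 11 := by omega
    interval_cases p <;> exact absurd hp (by norm_num)
  have e8 : 8 + 2 ≤ p ↔ 11 ≤ p := by
    refine ⟨fun h ↦ ?_, fun h ↦ by omega⟩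
    by_contra h'
    have hlo : 10 ≤ p := by omega
    have hhi : p < 11 := by omega
    interval_cases p
    exact absurd hp (by norm_num)
  exact ⟨⟨h4.2.trans e4, h4.1.trans e4⟩, ⟨h6'.2.trans e6, h6'.1.trans e6⟩, ⟨h8.2.trans e8, h8.1.trans e8⟩⟩

/-- **First instances beyond the fourfold table**: `(P⁶₄₉)`, `(Q⁶₇₇)`, `(Q⁶₉₁)` fail; `m = 121 = 11²` and `m = 143 = 11·13` are the first
composite levels prime to `6` where Shioda's method proves HC for the Fermat sixfold and eightfold (`(P⁶)`, `(P⁸)` hold, `(Q¹⁰)` fails);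
at `m = 1001 = 7·11·13`, `(P⁴)` holds and `(Q⁶)` fails. [cite: Shioda1979HodgeFermat, §4 pp. 183–184] [cite: Aoki1983, Thm A] -/
theorem instances :
    (¬ ShiodaConditionUpTo 49 6 ∧ ¬ ConditionQ 77 6 ∧ ¬ ConditionQ 91 6) ∧
    (ShiodaConditionUpTo 121 6 ∧ ShiodaConditionUpTo 121 8 ∧ ¬ ConditionQ 121 10) ∧
    (ShiodaConditionUpTo 143 6 ∧ ShiodaConditionUpTo 143 8 ∧ ¬ ConditionQ 143 10) ∧
    (ShiodaConditionUpTo 1001 4 ∧ ¬ ConditionQ 1001 6) := by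
  have h49 := composite_iff (m := 49) (by norm_num) (by norm_num) (by norm_num)
  have h77 := composite_iff (m := 77) (by norm_num) (by norm_num) (by norm_num)
  have h91 := composite_iff (m := 91) (by norm_num) (by norm_num) (by norm_num)
  have h121 := composite_iff (m := 121) (by norm_num) (by norm_num) (by norm_num)
  have h143 := composite_iff (m := 143) (by norm_num) (by norm_num) (by norm_num)
  have h1001 := composite_iff (m := 1001) (by norm_num) (by norm_num) (by norm_num)
  have e49 : Nat.minFac 49 = 7 := by norm_num
  have e77 : Nat.minFac 77 = 7 := by norm_num
  have e91 : Nat.minFac 91 = 7 := by norm_num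
  have e121 : Nat.minFac 121 = 11 := by norm_num
  have e143 : Nat.minFac 143 = 11 := by norm_num
  have e1001 : Nat.minFac 1001 = 7 := by norm_num
  refine ⟨⟨(h49 6).2.not.mpr ?_, (h77 6).1.not.mpr ?_, (h91 6).1.not.mpr ?_⟩,
    ⟨(h121 6).2.mpr ?_, (h121 8).2.mpr ?_, (h121 10).1.not.mpr ?_⟩,
    ⟨(h143 6).2.mpr ?_, (h143 8).2.mpr ?_, (h143 10).1.not.mpr ?_⟩,
    ⟨(h1001 4).2.mpr ?_, (h1001 6).1.not.mpr ?_⟩⟩ <;>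
    simp only [e49, e77, e91, e121, e143, e1001] <;> norm_num

end Summit.HodgeConjecture.FermatCycles.ConditionQCoprimeSixThreshold
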